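import Summits.Ventures.Crystal3D.Theorems.StickyWulffConstantGenericWallFloorSampleDeficitUpper
import Summits.Ventures.Crystal3D.Theorems.StickyWulffConstantTextureLiminfTexShadowLineCountUniform
import HarnessLib

/-!
# The clamped slab sample counts at most its two faces — with a constant UNIFORM in the grain

HONEST FRAMING. Part of the venture `Summits/Ventures/Crystal3D` (cell `crystal3d-full`), helper for the
crux `TextureLiminf` (stmt-Ventures-19483) of `route-Ventures-StickyWulffConstant`, line `TexShadow`, item n0
of the coordinator (DECISION (lvii)): the existing `affineSampleDeficit_upper` gives, for a moved fcc lattice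
`A Λ₀ + t` and a window of height `R`, a constant `C = C(A, R)` with
`D(P) ≤ 2 φ(A⁻¹e₃) π ρ² + C ρ` for every clamped sample `P` (`ρ ≥ R`); its `C` blows up like
`Σ_w 1/|⟪w, A⁻¹e₃⟫|` as the grain turns, which the texture argument (a limit over ALL orientations) cannot
use.  Here the constant is ABSOLUTE: `D(P) ≤ 2 φ(A⁻¹e₃) π ρ² + C (1 + R) ρ` with one `C` for all `A, t, R`.

The only change is the per-class line count: `card_filter_add_notMem_le_lineCount_unif` ends in
`lineCount_upper_uniform` (orthogonal shadow on `W^⊥`, swept ellipse) instead of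
`lineCount_upper_offset_window`; the horizontal classes were already uniform (rim-shell count).

**Theorem** (`affineSampleDeficit_upper_unif`): `∃ C, ∀ A t, ∀ R ≥ 1, ∀ a b (b - a = R), ∀ ρ ≥ R,
∀ P` the clamped sample of `A Λ₀ + t` in `{a ≤ x₂ ≤ b, x₀² + x₁² ≤ ρ²}`:
`contactDeficiency P ≤ 2 (√2/4 Σ_{‖w‖=1} |⟪w, A⁻¹e₃⟫|) π ρ² + C (1 + R) ρ`.

WHAT THIS IS NOT: no lower bound, nothing about two grains; consumers (lane F's uniform cell law, lane G's
one-sided ledgers, T's texture limit) are elsewhere.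
-/

noncomputable section

namespace Summit.Ventures.Crystal3D.Theorems

open Summit.Ventures.Crystal3D Finset Matrix InnerProductSpace
open Literature.MathematicalPhysics.StatisticalMechanics (barlowPos fccStacking constHagg haggLabel_const
  barlowPos_mem isHaggSeq_const contactDeficiency le_dist_of_mem_barlowStacking_ideal)

/-- Arithmetic of the horizontal classes: `S ≤ 6 (R + 2)(6ρ + 3)` with `R, ρ ≥ 1` gives
`S ≤ (60 √2 π + 162)(1 + R) ρ`. -/
theorem sampleDeficit_unif_arith_horizontal (R ρ S : ℝ) (hR : 1 ≤ R) (hρ : 1 ≤ ρ)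
    (hS : S ≤ 6 * ((R + 2) * (6 * ρ + 3))) :
    S ≤ (60 * Real.sqrt 2 * Real.pi + 162) * (1 + R) * ρ := by
  have h1 : (R + 2) * (6 * ρ + 3) ≤ (2 * (1 + R)) * (9 * ρ) := by nlinarith
  have h2 : 0 ≤ 60 * Real.sqrt 2 * Real.pi * ((1 + R) * ρ) := by
    have : 0 ≤ (1 + R) * ρ := by nlinarith
    positivity
  nlinarith

/-- Arithmetic of the transversal classes: the uniform line count
`X ≤ √2 |α| π (ρ + 2)² + 2 √2 π (ρ + R + 4)(R + 4)` with `|α| ≤ 1`, `1 ≤ R ≤ ρ` gives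
`X ≤ √2 |α| π ρ² + (60 √2 π + 162)(1 + R) ρ`. -/
theorem sampleDeficit_unif_arith_transversal (α R ρ X : ℝ) (hα : |α| ≤ 1) (hR : 1 ≤ R) (hρ : R ≤ ρ)
    (hX : X ≤ Real.sqrt 2 * |α| * Real.pi * (ρ + 2) ^ 2 +
      2 * Real.sqrt 2 * Real.pi * (ρ + R + 4) * (R + 4)) :
    X ≤ Real.sqrt 2 * |α| * Real.pi * ρ ^ 2 + (60 * Real.sqrt 2 * Real.pi + 162) * (1 + R) * ρ := by
  have hρ1 : 1 ≤ ρ := hR.trans hρ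
  have h0 : 0 ≤ |α| := abs_nonneg α
  have h1 : (ρ + R + 4) * (R + 4) ≤ 30 * ((1 + R) * ρ) := by nlinarith
  have h2 : |α| * (ρ + 2) ^ 2 ≤ |α| * ρ ^ 2 + 8 * ((1 + R) * ρ) := by
    have : (ρ + 2) ^ 2 = ρ ^ 2 + (4 * ρ + 4) := by ring
    rw [this, mul_add]
    have h3 : |α| * (4 * ρ + 4) ≤ 1 * (8 * ρ) := by
      apply mul_le_mul hα (by linarith) (by linarith) zero_le_one
    nlinarith
  have hc : 0 ≤ Real.sqrt 2 * Real.pi := by positivity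
  have h4 := mul_le_mul_of_nonneg_left h1 hc
  have h5 := mul_le_mul_of_nonneg_left h2 hc
  have h6 : 0 ≤ (1 + R) * ρ := by nlinarith
  have hX' : X ≤ Real.sqrt 2 * Real.pi * (|α| * (ρ + 2) ^ 2) +
      2 * (Real.sqrt 2 * Real.pi * ((ρ + R + 4) * (R + 4))) := by
    refine hX.trans (le_of_eq ?_); ring
  have h22 : Real.sqrt 2 ≤ 2 := (Real.sqrt_le_left (show (0 : ℝ) ≤ 2 by norm_num)).2 (by norm_num)
  have hK8 : Real.sqrt 2 * Real.pi ≤ 2 * 4 :=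
    mul_le_mul h22 Real.pi_le_four Real.pi_pos.le (by norm_num)
  have h7 := mul_le_mul_of_nonneg_right hK8 h6
  have hgoal : Real.sqrt 2 * Real.pi * (|α| * ρ ^ 2 + 8 * ((1 + R) * ρ)) +
      2 * (Real.sqrt 2 * Real.pi * (30 * ((1 + R) * ρ))) ≤
      Real.sqrt 2 * |α| * Real.pi * ρ ^ 2 + (60 * Real.sqrt 2 * Real.pi + 162) * (1 + R) * ρ := by
    linarith
  linarith

/-- **Runs of a transversal class, from above, uniformly.**  `card_filter_add_notMem_le_lineCount` with
the uniform line count: for the sample `P ⊆ Λ₀` of the window `lo ≤ ⟪q + s, ν⟫ ≤ lo + R`,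
`‖q + s‖² - ⟪q + s, ν⟫² ≤ ρ²` and a transversal slot `W` (chart `Ea, Eb, W`, `fa, fb, ft`),
`#{p ∈ P : p + W ∉ P} ≤ √2 |⟪W, ν⟫| π (ρ + 2)² + 2 √2 π (ρ + R + 4)(R + 4)`. -/
theorem card_filter_add_notMem_le_lineCount_unif (ν s : EuclideanSpace ℝ (Fin 3)) (hν : ‖ν‖ = 1)
    (lo R ρ : ℝ) (hR : 0 ≤ R) (hρ : 0 ≤ ρ)
    (P : Finset (EuclideanSpace ℝ (Fin 3)))
    (hP : ∀ q, q ∈ P ↔ (q ∈ fccStacking 1 (Real.sqrt (2 / 3)) ∧ lo ≤ ⟪q + s, ν⟫_ℝ ∧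
      ⟪q + s, ν⟫_ℝ ≤ lo + R ∧ ‖q + s‖ ^ 2 - ⟪q + s, ν⟫_ℝ ^ 2 ≤ ρ ^ 2))
    (Ea Eb W : EuclideanSpace ℝ (Fin 3)) (hEa : ‖Ea‖ ≤ 1) (hEb : ‖Eb‖ ≤ 1) (hW : ‖W‖ = 1)
    (hdet : (Matrix.det ![WithLp.ofLp Ea, WithLp.ofLp Eb, WithLp.ofLp W]) ^ 2 = 1 / 2)
    (hα : ⟪W, ν⟫_ℝ ≠ 0) (hWslot : W ∈ fccSlots)
    (fa fb ft : ℤ → ℤ → ℤ → ℤ)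
    (hchart : ∀ k i j : ℤ, barlowPos 1 (Real.sqrt (2 / 3)) constHagg k i j =
      (fa k i j : ℝ) • Ea + (fb k i j : ℝ) • Eb + (ft k i j : ℝ) • W) :
    ((P.filter fun p => p + W ∉ P).card : ℝ) ≤
      Real.sqrt 2 * |⟪W, ν⟫_ℝ| * Real.pi * (ρ + 2) ^ 2 +
        2 * Real.sqrt 2 * Real.pi * (ρ + R + 4) * (R + 4) := by
  classical
  set F := P.filter fun p => p + W ∉ P with hF
  -- integer coordinates of the points of `F`
  have hcoord : ∀ p ∈ F, ∃ k i j : ℤ, p = barlowPos 1 (Real.sqrt (2 / 3)) constHagg k i j := by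
    intro p hp
    exact ((hP p).1 (mem_filter.1 hp).1).1
  choose! kf pf qf hc using hcoord
  -- the line index
  set idx : EuclideanSpace ℝ (Fin 3) → ℤ × ℤ := fun p =>
    (fa (kf p) (pf p) (qf p), fb (kf p) (pf p) (qf p)) with hidx
  have hrepr : ∀ p ∈ F, p = ((idx p).1 : ℝ) • Ea + ((idx p).2 : ℝ) • Eb +
      (ft (kf p) (pf p) (qf p) : ℝ) • W := by
    intro p hp
    conv_lhs => rw [hc p hp]
    rw [hchart]
  -- convexity: at most one point of `F` per line
  have hconv := convex_offsetSampleRegion ν s hν lo R ρ hρ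
  have hinj : Set.InjOn idx ↑F := by
    intro p hp p' hp' hpp'
    have hpF := mem_coe.1 hp
    have hp'F := mem_coe.1 hp'
    have ep := hrepr p hpF
    have ep' := hrepr p' hp'F
    rw [← hpp'] at ep'
    set t : ℤ := ft (kf p) (pf p) (qf p)
    set t' : ℤ := ft (kf p') (pf p') (qf p')
    have hdiff : p' = p + ((t' : ℝ) - t) • W := by
      calc p' = ((idx p).1 : ℝ) • Ea + ((idx p).2 : ℝ) • Eb + (t' : ℝ) • W := ep'
        _ = (((idx p).1 : ℝ) • Ea + ((idx p).2 : ℝ) • Eb + (t : ℝ) • W) + ((t' : ℝ) - t) • W := by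
            module
        _ = p + ((t' : ℝ) - t) • W := by rw [← ep]
    -- the key step: if `t < t'` then `p + W` lies on the segment `[p, p']` inside the sample
    have key : ∀ (x y : EuclideanSpace ℝ (Fin 3)) (m : ℤ), x ∈ F → y ∈ P → y = x + (m : ℝ) • W →
        1 ≤ m → False := by
      intro x y m hx hy hyx hm
      have hxP : x ∈ P := (mem_filter.1 hx).1
      have hxW : x + W ∉ P := (mem_filter.1 hx).2
      apply hxW
      rw [hP]
      refine ⟨add_mem_fcc_of_mem_fccSlots ((hP x).1 hxP).1 hWslot, ?_⟩
      -- `x + W = (1 - 1/m) • x + (1/m) • y`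
      have hmR : (1 : ℝ) ≤ m := by exact_mod_cast hm
      have hm0 : (0 : ℝ) < m := by linarith
      have hcvx : x + W = (1 - 1 / (m : ℝ)) • x + (1 / (m : ℝ)) • y := by
        rw [hyx, smul_add, smul_smul, one_div, inv_mul_cancel₀ hm0.ne', one_smul]
        module
      have hxK := ((hP x).1 hxP).2
      have hyK := ((hP y).1 hy).2
      have hmem := hconv (x := x) (y := y) hxK hyK (a := 1 - 1 / (m : ℝ)) (b := 1 / (m : ℝ))
        (by rw [sub_nonneg, div_le_one hm0]; exact hmR) (by positivity) (by ring)
      rw [← hcvx] at hmem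
      exact hmem
    rcases lt_trichotomy t t' with hlt | heq | hgt
    · exact (key p p' (t' - t) hpF (mem_filter.1 hp'F).1 (by rw [hdiff]; push_cast; rfl)
        (by omega)).elim
    · rw [hdiff, heq, sub_self, zero_smul, add_zero]
    · refine (key p' p (t - t') hp'F (mem_filter.1 hpF).1 ?_ (by omega)).elim
      rw [hdiff]; push_cast; module
  -- the image satisfies the hypothesis of the uniform line count
  set T := F.image idx with hT
  have hcard : (F.card : ℝ) = (T.card : ℝ) := by rw [hT, card_image_of_injOn hinj]
  rw [hcard]
  refine lineCount_upper_uniform ν hν R ρ lo hR hρ Ea Eb W s hEa hEb hW hdet hα T ?_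
  intro ab hab
  obtain ⟨p, hp, rfl⟩ := mem_image.1 hab
  refine ⟨ft (kf p) (pf p) (qf p), ?_⟩
  have hpP := ((hP p).1 (mem_filter.1 hp).1).2
  rw [← hrepr p hp]
  exact hpP

/-- **Uniform upper bound for the clamped slab sample of a moved fcc lattice.**  One absolute constant
`C` such that for every rigid motion `x ↦ A x + t`, every window height `R ≥ 1`, `b - a = R`, every
`ρ ≥ R` and the clamped sample `P = (A Λ₀ + t) ∩ {a ≤ x₂ ≤ b, x₀² + x₁² ≤ ρ²}`:
`contactDeficiency P ≤ 2 (√2/4 Σ_{w ∈ Λ₀, ‖w‖ = 1} |⟪w, A⁻¹e₃⟫|) π ρ² + C (1 + R) ρ`. -/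
theorem affineSampleDeficit_upper_unif : ∃ C : ℝ,
    ∀ (A : EuclideanSpace ℝ (Fin 3) ≃ₗᵢ[ℝ] EuclideanSpace ℝ (Fin 3)) (t : EuclideanSpace ℝ (Fin 3))
      (R : ℝ), 1 ≤ R → ∀ a b : ℝ, b - a = R → ∀ ρ : ℝ, R ≤ ρ →
      ∀ P : Finset (EuclideanSpace ℝ (Fin 3)),
        (∀ p, p ∈ P ↔ (p ∈ (fun q => A q + t) '' fccStacking 1 (Real.sqrt (2 / 3)) ∧
          a ≤ p 2 ∧ p 2 ≤ b ∧ p 0 ^ 2 + p 1 ^ 2 ≤ ρ ^ 2)) →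
        contactDeficiency P ≤
          2 * (Real.sqrt 2 / 4 * ∑ᶠ w ∈ {w ∈ fccStacking 1 (Real.sqrt (2 / 3)) | ‖w‖ = 1},
            |⟪w, A.symm (EuclideanSpace.single (2 : Fin 3) (1 : ℝ))⟫_ℝ|) * Real.pi * ρ ^ 2 +
            C * (1 + R) * ρ := by
  classical
  set c₀ : ℝ := 60 * Real.sqrt 2 * Real.pi + 162 with hc₀
  refine ⟨1 / 2 * ∑ w ∈ fccSlots, c₀, ?_⟩
  intro A t R hR a b hab ρ hρ P hP
  set e₃ : EuclideanSpace ℝ (Fin 3) := EuclideanSpace.single (2 : Fin 3) (1 : ℝ) with he₃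
  set ν : EuclideanSpace ℝ (Fin 3) := A.symm e₃ with hν
  set s : EuclideanSpace ℝ (Fin 3) := A.symm t with hs
  have hρ1 : 1 ≤ ρ := hR.trans hρ
  have hρ0 : 0 ≤ ρ := by linarith
  have hR0 : 0 ≤ R := by linarith
  have he₃n : ‖e₃‖ = 1 := by rw [he₃, PiLp.norm_single, norm_one]
  have hνn : ‖ν‖ = 1 := by rw [hν, LinearIsometryEquiv.norm_map, he₃n]
  have hAν : A ν = e₃ := by rw [hν, LinearIsometryEquiv.apply_symm_apply]
  have hAs : A s = t := by rw [hs, LinearIsometryEquiv.apply_symm_apply]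
  -- the motion, its inverse, coordinates (as in `affineSampleDeficit_upper`)
  set g : EuclideanSpace ℝ (Fin 3) → EuclideanSpace ℝ (Fin 3) := fun q => A q + t with hg
  set ginv : EuclideanSpace ℝ (Fin 3) → EuclideanSpace ℝ (Fin 3) := fun p => A.symm (p - t) with hginv
  have hg_ginv : ∀ p, g (ginv p) = p := by
    intro p; simp only [hg, hginv, LinearIsometryEquiv.apply_symm_apply]; abel
  have hginv_g : ∀ q, ginv (g q) = q := by
    intro q; simp only [hg, hginv, add_sub_cancel_right, LinearIsometryEquiv.symm_apply_apply]
  have hginv_iso : Isometry ginv := by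
    intro p q; simp only [hginv, edist_dist, LinearIsometryEquiv.dist_map, dist_sub_right]
  have hgq : ∀ q, g q = A (q + s) := by intro q; simp only [hg, map_add, hAs]
  have h2 : ∀ q, g q 2 = ⟪q + s, ν⟫_ℝ := by
    intro q
    have : g q 2 = ⟪g q, e₃⟫_ℝ := by rw [he₃, EuclideanSpace.inner_single_right]; simp
    rw [this, hgq, ← hAν, LinearIsometryEquiv.inner_map_map]
  have hlat : ∀ q, g q 0 ^ 2 + g q 1 ^ 2 = ‖q + s‖ ^ 2 - ⟪q + s, ν⟫_ℝ ^ 2 := by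
    intro q
    rw [sq_add_sq_eq_norm_sq_sub, ← he₃, hgq, LinearIsometryEquiv.norm_map, ← hAν,
      LinearIsometryEquiv.inner_map_map]
  -- the pulled-back sample
  set P' : Finset (EuclideanSpace ℝ (Fin 3)) := P.image ginv with hP'
  have hmemP' : ∀ q, q ∈ P' ↔ g q ∈ P := by
    intro q; rw [hP', mem_image]
    constructor
    · rintro ⟨p, hp, rfl⟩; rw [hg_ginv]; exact hp
    · intro hq; exact ⟨g q, hq, hginv_g q⟩
  have himg : ∀ q, g q ∈ (fun q => A q + t) '' fccStacking 1 (Real.sqrt (2 / 3)) ↔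
      q ∈ fccStacking 1 (Real.sqrt (2 / 3)) := by
    intro q; constructor
    · rintro ⟨q', hq', hqq'⟩
      have : q' = q := by
        have h1 : ginv (g q') = ginv (g q) := congrArg ginv hqq'
        rwa [hginv_g, hginv_g] at h1
      rw [← this]; exact hq'
    · intro hq; exact ⟨q, hq, rfl⟩
  have hP'iff : ∀ q, q ∈ P' ↔ (q ∈ fccStacking 1 (Real.sqrt (2 / 3)) ∧ a ≤ ⟪q + s, ν⟫_ℝ ∧
      ⟪q + s, ν⟫_ℝ ≤ a + R ∧ ‖q + s‖ ^ 2 - ⟪q + s, ν⟫_ℝ ^ 2 ≤ ρ ^ 2) := by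
    intro q; rw [hmemP', hP (g q), h2, hlat, ← hab, add_sub_cancel, himg]
  have hP'fcc : ∀ q ∈ P', q ∈ fccStacking 1 (Real.sqrt (2 / 3)) := fun q hq => ((hP'iff q).1 hq).1
  have hDP : contactDeficiency P = contactDeficiency P' := by
    rw [hP', contactDeficiency_image_of_isometry hginv_iso]
  -- the slot sum
  rw [hDP, contactDeficiency_eq_half_sum_card_empty P' hP'fcc]
  -- per-slot bounds
  have hslot : ∀ w ∈ fccSlots, ((P'.filter fun p => p + w ∉ P').card : ℝ) ≤
      Real.sqrt 2 * |⟪w, ν⟫_ℝ| * Real.pi * ρ ^ 2 + c₀ * (1 + R) * ρ := by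
    intro w hw
    have hwn : ‖w‖ = 1 := norm_eq_one_of_mem_fccSlots hw
    by_cases hα : ⟪w, ν⟫_ℝ = 0
    · -- horizontal slot: the points `g (p + w)` are rim balls of the moved sample
      rw [hα, abs_zero, mul_zero, zero_mul, zero_mul, zero_add]
      set F := P'.filter fun p => p + w ∉ P' with hF
      set S := F.image fun q => g (q + w) with hS
      have hinjS : Set.InjOn (fun q => g (q + w)) ↑F := by
        intro q _ q' _ h
        have h1 := congrArg ginv h
        simp only [hginv_g] at h1
        exact add_right_cancel h1
      have hcardS : (F.card : ℝ) = (S.card : ℝ) := by rw [hS, card_image_of_injOn hinjS]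
      -- separation and shell membership of `S`
      have hSsep : ∀ x ∈ S, ∀ y ∈ S, x ≠ y → 1 ≤ dist x y := by
        intro x hx y hy hxy
        obtain ⟨q, hq, rfl⟩ := mem_image.1 hx
        obtain ⟨q', hq', rfl⟩ := mem_image.1 hy
        have hqf := hP'fcc q (mem_filter.1 hq).1
        have hq'f := hP'fcc q' (mem_filter.1 hq').1
        have hne : q + w ≠ q' + w := by
          intro h; apply hxy; rw [h]
        rw [hgq, hgq, LinearIsometryEquiv.dist_map, dist_add_right]
        exact le_dist_of_mem_barlowStacking_ideal isHaggSeq_const one_pos fcc_height_sq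
          (add_mem_fcc_of_mem_fccSlots hqf hw) (add_mem_fcc_of_mem_fccSlots hq'f hw) hne
      have hSmem : ∀ x ∈ S, a ≤ x 2 ∧ x 2 ≤ b ∧ ρ ^ 2 < x 0 ^ 2 + x 1 ^ 2 ∧
          x 0 ^ 2 + x 1 ^ 2 ≤ (ρ + 1) ^ 2 := by
        intro x hx
        obtain ⟨q, hq, rfl⟩ := mem_image.1 hx
        obtain ⟨hqP, hqw⟩ := mem_filter.1 hq
        obtain ⟨hqf, h1, h2q, h3⟩ := (hP'iff q).1 hqP
        have hinw : ⟪q + w + s, ν⟫_ℝ = ⟪q + s, ν⟫_ℝ := by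
          rw [show q + w + s = (q + s) + w by abel, inner_add_left, hα, add_zero]
        rw [h2, hlat, hinw]
        refine ⟨h1, by linarith, ?_, ?_⟩
        · -- `q + w ∉ P'` although it is a site in the window: the lateral condition fails
          by_contra hle
          push Not at hle
          apply hqw
          rw [hP'iff]
          exact ⟨add_mem_fcc_of_mem_fccSlots hqf hw, by rw [hinw]; exact h1, by rw [hinw]; exact h2q,
            by rw [hinw]; exact hle⟩
        · -- lateral parts add: `‖(x + w)_lat‖ ≤ ‖x_lat‖ + ‖w_lat‖ ≤ ρ + 1`
          rw [← hinw, ← norm_sub_inner_smul_sq ν _ hνn]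
          have hx3 : ‖(q + s) - ⟪q + s, ν⟫_ℝ • ν‖ ≤ ρ := by
            have : ‖(q + s) - ⟪q + s, ν⟫_ℝ • ν‖ ^ 2 ≤ ρ ^ 2 := by
              rw [norm_sub_inner_smul_sq ν _ hνn]; exact h3
            exact (pow_le_pow_iff_left₀ (norm_nonneg _) hρ0 two_ne_zero).1 this
          have hw3 : ‖w - ⟪w, ν⟫_ℝ • ν‖ ≤ 1 := by
            rw [hα, zero_smul, sub_zero, hwn]
          have hsplit : (q + w + s) - ⟪q + w + s, ν⟫_ℝ • ν =
              ((q + s) - ⟪q + s, ν⟫_ℝ • ν) + (w - ⟪w, ν⟫_ℝ • ν) := by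
            rw [show q + w + s = (q + s) + w by abel, inner_add_left, add_smul]; abel
          rw [hsplit]
          have hle : ‖((q + s) - ⟪q + s, ν⟫_ℝ • ν) + (w - ⟪w, ν⟫_ℝ • ν)‖ ≤ ρ + 1 :=
            (norm_add_le _ _).trans (add_le_add hx3 hw3)
          exact pow_le_pow_left₀ (norm_nonneg _) hle 2
      have hshell := card_mul_le_of_separated_in_shell S hSsep a b ρ (ρ + 1) (by linarith) hρ1
        (by linarith) hSmem
      rw [hcardS]
      have hbma : b - a + 2 = R + 2 := by rw [hab]
      rw [hbma] at hshell
      have hring : (R + 2) * (Real.pi * (ρ + 1 + 1) ^ 2 - Real.pi * (ρ - 1) ^ 2) =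
          Real.pi * ((R + 2) * (6 * ρ + 3)) := by ring
      rw [hring] at hshell
      have hS' : (S.card : ℝ) ≤ 6 * ((R + 2) * (6 * ρ + 3)) := by
        by_contra hcon
        push Not at hcon
        nlinarith [Real.pi_pos, hshell, hcon]
      rw [hc₀]
      exact sampleDeficit_unif_arith_horizontal R ρ _ hR hρ1 hS'
    · -- transversal slot: the chart and the UNIFORM line count
      obtain ⟨Ea, Eb, hEa, hEb, hdet, fa, fb, ft, hchart⟩ := exists_chart_of_mem_fccSlots hw
      have hcount := card_filter_add_notMem_le_lineCount_unif ν s hνn a R ρ hR0 hρ0 P' hP'iff Ea Eb w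
        hEa hEb hwn hdet hα hw fa fb ft hchart
      have hαle : |⟪w, ν⟫_ℝ| ≤ 1 := by
        have h := abs_real_inner_le_norm w ν; rw [hνn, hwn, mul_one] at h; exact h
      rw [hc₀]
      exact sampleDeficit_unif_arith_transversal _ R ρ _ hαle hR hρ hcount
  -- sum the per-slot bounds
  have hsum : ∑ w ∈ fccSlots, ((P'.filter fun p => p + w ∉ P').card : ℝ) ≤
      ∑ w ∈ fccSlots, (Real.sqrt 2 * |⟪w, ν⟫_ℝ| * Real.pi * ρ ^ 2 + c₀ * (1 + R) * ρ) :=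
    sum_le_sum hslot
  rw [finsum_unit_fcc_eq_sum]
  have hrew : ∑ w ∈ fccSlots, (Real.sqrt 2 * |⟪w, ν⟫_ℝ| * Real.pi * ρ ^ 2 + c₀ * (1 + R) * ρ) =
      Real.sqrt 2 * Real.pi * ρ ^ 2 * ∑ w ∈ fccSlots, |⟪w, ν⟫_ℝ| +
        (1 + R) * ρ * ∑ w ∈ fccSlots, c₀ := by
    rw [sum_add_distrib, mul_sum, mul_sum]
    congr 1 <;> refine sum_congr rfl fun w _ => by ring
  rw [hrew] at hsum
  have hfinal : 1 / 2 * ∑ w ∈ fccSlots, ((P'.filter fun p => p + w ∉ P').card : ℝ) ≤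
      1 / 2 * (Real.sqrt 2 * Real.pi * ρ ^ 2 * ∑ w ∈ fccSlots, |⟪w, ν⟫_ℝ| +
        (1 + R) * ρ * ∑ w ∈ fccSlots, c₀) := by linarith
  refine hfinal.trans (le_of_eq ?_)
  ring

end Summit.Ventures.Crystal3D.Theorems

end
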